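import Literature.Geometry.Lorentzian.KillingHorizonShadowAlong
import Literature.Geometry.Lorentzian.KerrDataProofs
import Literature.Geometry.Lorentzian.KerrSchildCoord
import Summits.FinalStateConjecture.FinalStateConjecture.Theorems.BartnikGapSettlingBondiBartnikRigidityKillingDomainCausal
import HarnessLib

/-!
# The checked reduction of K2 (`stub_stationaryKerrCollarExtension`) — line `direct-method-on-the-cone`
# (crux `BondiBartnikRigidity`, stmt-FinalStateConjecture-10807), wave 1 of lead a2 (worker K2)

K2 says: a maximal vacuum Cauchy development of arbitrary smooth data with ONE exact thick Kerr
collar on its Cauchy slice, a cut Bondi energy of the core (outer roof reaching null infinity) and a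
Killing field on the interior of the Killing domain equal to the Kerr-star time translation on an
exact shell box, contains exact Kerr-star boxes of every radius and length inside `J⁺(C)`.  This
file records the honest route found in wave 1 as three named statements in the tree's vocabulary
and PROVES the reduction (pure bookkeeping; the Kerr chart facts `[Kerr.Facts]` are discharged):

  `K2_of_route : OuterRoofChart → RoofDevelopmentExtension → KerrLateBoxPlacement → K2`

(its closed form is the registered sub-goal `stub_stationaryKerrCollarExtensionOfRoute`), where

* `OuterRoofChart` (F4', OPEN — where K2's difficulty lives): the Killing development carries, for
  every radius `ρ`, a ROOF CHART (`IsRoofChart`): an exact chart of the collar background on the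
  pull-back of a Kerr-side one-sided neighbourhood of the roof portion `C⁺(S₃) ∩ {r ≤ ρ}`, continuous
  up to it, mapping it into `∂J⁺(C)`, matching the collar chart on `S₃`, on which `ξ = dΨ(Λe₀)`.
  Ingredients on paper: slab-jet Cauchy rigidity, Müller zum Hagen analyticity where `ξ` is timelike,
  developing-map continuation of the local Kerr isometry (the local Kerr radius is monotone `≥ 3M`
  along the roof, so no ergosurface forms ON the roof), reach to every radius from `HasCutBondiMass`;
  the open point is one-sided control of `ξ` near the roof outside the exact diamond;
* `RoofDevelopmentExtension` (F5, MISSING, true on paper): exact slab + roof charts for every radius ⇒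
  an exact chart on the pull-back of the truncated open causal future `J⁺_K(slab)° ∩ {t* < T₀, r < ρ}`
  with image in `J⁺(C)` — uniqueness for the vacuum Cauchy–characteristic problem (Rendall 1990) plus
  maximality (Choquet-Bruhat–Geroch 1969; Hawking–Ellis §7.6);
* `KerrLateBoxPlacement` (F6, pure Kerr causal geometry in the star chart, closable): for all `R, T`
  some late box `{τ < t* < τ + T, M < r < R + 1}` lies in `J⁺_K(slab)° ∩ {t* < T₀, r < ρ}`.

Also here: F1 `SlabCauchyRigidity` (exact slab jet ⇒ exact chart on the future inner diamond inside the
interior of the Killing domain — the shared first ingredient of K1 and of F4'; local vacuum uniqueness +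
localisation, Hawking–Ellis §7.5–7.6, cf. the tree's named fact `hawkingEllis_locallyUnique_vacuumDevelopment`)
with the star-background regions `slabDiamond`, `slabDiamondWithSlab`, `outerSphere`, `outerRoof`; the
Kerr-side sets (`JK`, `slabK`, `outerSphereK`, `roofK`, `truncFutureK`, `boxK`), the
pull-back `pullK` along the rest-frame map with `pullK_mono`, `coordBox_subset_pullK_boxK`, and the
hypothesis block `IsRoofChart`.  Nothing is asserted about F4'/F5/F6 (route-posited statements,
tagged accordingly); the typed ingredients F1–F3 of F4' and the typing audit are in the worker report
attached to the crux item (`K2-report-a2.md`) and in `Cruxes/…/Lines/direct-method-on-the-cone-K2route.lean`.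

References: Rendall 1990, Thm. 1 [Rendall1990]; Choquet-Bruhat–Geroch 1969, Thm. 3
[ChoquetBruhatGeroch1969CMP]; Hawking–Ellis 1973, §7.6 [HawkingEllis1973CUP]; Müller zum Hagen 1970
[MullerZumHagen1970]; Carter 1968, §3 [Carter1968]; Dafermos–Rodnianski arXiv:0811.0354, §5.1
[DafermosRodnianski2008]; O'Neill 1995, Ch. 4 [ONeill1995].
-/

noncomputable section

-- D-0017: single-problem summit, `Summit.<S>.<S>.…` by design (cf. lakefile `weak.linter.dupNamespace`).
set_option linter.dupNamespace false
-- instance search through the nested operator types of the Kerr chart facts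
set_option maxSynthPendingDepth 3

open Set Filter Function Topology TopologicalSpace
open Literature.Geometry.Lorentzian
open scoped Manifold ContDiff Topology ENNReal

namespace Summit.FinalStateConjecture.FinalStateConjecture.Theorems.BondiBartnikRigidity.DirectMethod

universe u

variable {X : Type u} [TopologicalSpace X] [ChartedSpace E3 X] [IsManifold (𝓡 3) ∞ X]
  [ConnectedSpace X] {D : InitialDataSet (𝓡 3) X}

/-! ### The Kerr side: causal sets of the (unboosted) Kerr star chart `Kerr.spacetime M a M` -/

section KerrSide

variable [Kerr.Facts]

/-- `J⁺` of the bundled Kerr star spacetime `({r > M}, g_{M,a}, −g♯dt*)` (`Kerr.spacetime M a M`,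
which needs `0 ≤ M` and the named-fact class `[Kerr.Facts]`). -/
def JK (M a : ℝ) (hM : 0 < M) (S : Set (Kerr.region a M)) : Set (Kerr.region a M) :=
  (Kerr.spacetime M a M hM.le).metric.causalFuture (Kerr.spacetime M a M hM.le).timeOrientation S

/-- The Kerr-side thick slab `{t* = 0, M < r ≤ 3M}`. -/
def slabK (M a : ℝ) : Set (Kerr.region a M) := {y | y.1 0 = 0 ∧ Kerr.radius a y.1 ≤ 3 * M}

/-- The Kerr-side outer edge sphere `S₃ = {t* = 0, r = 3M}`. -/
def outerSphereK (M a : ℝ) : Set (Kerr.region a M) := {y | y.1 0 = 0 ∧ Kerr.radius a y.1 = 3 * M}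

/-- The Kerr-side OUTER ROOF `C⁺(S₃) = ∂J⁺(slab) ∩ J⁺(S₃)` (in exact Kerr the advanced time `v` is
non-decreasing along future causal curves, so no point of the inner sheet `{v = M}` lies in
`J⁺(S₃) ⊆ {v ≥ 3M}` and this IS the cone ruled from `S₃`). -/
def roofK (M a : ℝ) (hM : 0 < M) : Set (Kerr.region a M) :=
  frontier (JK M a hM (slabK M a)) ∩ JK M a hM (outerSphereK M a)

/-- The truncated open causal future `J⁺(slab)° ∩ {t* < T₀, r < ρ}` of the Kerr slab. -/
def truncFutureK (M a : ℝ) (hM : 0 < M) (ρ T₀ : ℝ) : Set (Kerr.region a M) :=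
  interior (JK M a hM (slabK M a)) ∩ {y | y.1 0 < T₀ ∧ Kerr.radius a y.1 < ρ}

/-- A Kerr-side coordinate box `{τ₁ < t* < τ₂, r₁ < r < r₂}`. -/
def boxK (M a τ₁ τ₂ r₁ r₂ : ℝ) : Set (Kerr.region a M) :=
  {y | τ₁ < y.1 0 ∧ y.1 0 < τ₂ ∧ r₁ < Kerr.radius a y.1 ∧ Kerr.radius a y.1 < r₂}

omit [Kerr.Facts] in
/-- Pull-back of a Kerr-side set to the domain of a (boosted) background along the rest-frame map
`x ↦ Λ⁻¹(x − c)` (for the collar background `B = starBackground Λ c M a (r_a ∘ (Λ,c)⁻¹)` this map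
IS the identification of `B.domain` with `Kerr.region a M`). -/
def pullK (mo : lorentzGroup × E4) (M a : ℝ) (B : ModelBackground) (S : Set (Kerr.region a M)) :
    Set B.domain :=
  {x | ∃ h : poincareInv mo.1 mo.2 x.1 ∈ Kerr.region a M, (⟨poincareInv mo.1 mo.2 x.1, h⟩ : Kerr.region a M) ∈ S}

omit [Kerr.Facts] in
/-- `pullK` is monotone in the Kerr-side set. [folklore] -/
theorem pullK_mono (mo : lorentzGroup × E4) (M a : ℝ) (B : ModelBackground)
    {S T : Set (Kerr.region a M)} (h : S ⊆ T) : pullK mo M a B S ⊆ pullK mo M a B T :=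
  fun _ ⟨hx, hS⟩ ↦ ⟨hx, h hS⟩

omit [Kerr.Facts] in
/-- The coordinate box of the collar background is the pull-back of the Kerr-side box. -/
theorem coordBox_subset_pullK_boxK {mo : lorentzGroup × E4} {M a : ℝ} {B : ModelBackground}
    (hB : B = starBackground mo.1 mo.2 M a (fun x => Kerr.radius a (poincareInv mo.1 mo.2 x)))
    (τ₁ τ₂ r₁ r₂ : ℝ) : coordBox B τ₁ τ₂ r₁ r₂ ⊆ pullK mo M a B (boxK M a τ₁ τ₂ r₁ r₂) := by
  subst hB
  intro x hx
  exact ⟨x.2, hx⟩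

/-- **ROOF CHART** — the hypothesis block shared by F4 (as conclusion) and F5 (as hypothesis): an
exact chart `Ψ_N` of the collar background on the pull-back of a Kerr-side one-sided neighbourhood
`O ∩ J⁺(slab)°` of the roof portion `C⁺(S₃) ∩ {r ≤ ρ}`, continuous up to that roof portion, which it
maps onto the achronal boundary `∂J⁺(C)` of the development, matching the collar chart on `S₃`,
with image of the open part in `J`. -/
def IsRoofChart {𝒮 : Spacetime.{0} 4} (mo : lorentzGroup × E4) (M a : ℝ) (hM : 0 < M)
    (B : ModelBackground) (C J : Set 𝒮.carrier) (Φ₀ : B.domain → 𝒮.carrier) (ρ : ℝ)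
    (O : Set (Kerr.region a M)) (Ψ : B.domain → 𝒮.carrier) : Prop :=
  IsOpen O ∧ roofK M a hM ∩ {y | Kerr.radius a y.1 ≤ ρ} ⊆ O ∧
  ContMDiffOn 𝓘(ℝ, E4) (𝓡 4) ∞ Ψ (pullK mo M a B (O ∩ interior (JK M a hM (slabK M a)))) ∧
  IsOpenEmbedding ((pullK mo M a B (O ∩ interior (JK M a hM (slabK M a)))).restrict Ψ) ∧
  Ψ '' pullK mo M a B (O ∩ interior (JK M a hM (slabK M a))) ⊆ J ∧
  supCkENorm (Subtype.val '' pullK mo M a B (O ∩ interior (JK M a hM (slabK M a)))) 0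
    (𝒮.deviationExtend B Ψ) ≤ 0 ∧
  ContinuousOn Ψ (pullK mo M a B (O ∩ (interior (JK M a hM (slabK M a)) ∪ roofK M a hM))) ∧
  Ψ '' pullK mo M a B (O ∩ roofK M a hM) ⊆ frontier (𝒮.metric.causalFuture 𝒮.timeOrientation C) ∧
  ∀ x ∈ pullK mo M a B (outerSphereK M a), Ψ x = Φ₀ x

end KerrSide



namespace K2Route

/-! ### Regions of the star background named in Kerr-star coordinates -/

/-- The open FUTURE INNER DIAMOND `Δ = {0 < t*, t* + r < 3M}` of the thick slab
`{t* = 0, M < r ≤ 3M}` (within the star domain `{r > M}`): bounded by the slab and by the INGOING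
null hypersurface `N̲ = {v := t* + r = 3M}` through the outer edge sphere `S₃` (in ingoing
Kerr / Kerr-star coordinates `v = t_KS + r` is constant along the ingoing principal null
congruence, so `{v = const}` is null for every `a`).  On paper: `Δ = D⁺_Kerr(slab)° ∩ {r > M}`. -/
def slabDiamond (B : ModelBackground) (M : ℝ) : Set B.domain :=
  {x | 0 < B.time x.1 ∧ B.time x.1 + B.radius x.1 < 3 * M}

/-- The closed-below diamond `{0 ≤ t*, t* + r < 3M}` (the diamond together with the open slab). -/
def slabDiamondWithSlab (B : ModelBackground) (M : ℝ) : Set B.domain :=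
  {x | 0 ≤ B.time x.1 ∧ B.time x.1 + B.radius x.1 < 3 * M}

/-- The outer edge sphere `S₃ = {t* = 0, r = 3M}` of the thick slab. -/
def outerSphere (B : ModelBackground) (M : ℝ) : Set B.domain :=
  {x | B.time x.1 = 0 ∧ B.radius x.1 = 3 * M}

variable {X : Type} [TopologicalSpace X] [ChartedSpace E3 X] [IsManifold (𝓡 3) ∞ X]
  [ConnectedSpace X] {D : InitialDataSet (𝓡 3) X}

/-- The OUTER ROOF `N₊` of the core `C`: the points of the achronal boundary `∂J⁺(C)` joined to the
image of the outer edge sphere `Φ₀(S₃)` by a future causal curve LYING IN `∂J⁺(C)` — i.e. the part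
of `∂J⁺(C)` ruled by the null generators leaving `S₃` (robust against the inner sheet `N₋` from the
inner edge `{r = M}`, which no generator from `S₃` reaches). -/
def outerRoof (𝒱 : VacuumCauchyDevelopment D) (M : Fin 1 → ℝ) (p : 𝒱.carrier)
    (B : Fin 1 → ModelBackground) (Φ : ∀ i, (B i).domain → 𝒱.carrier) : Set 𝒱.carrier :=
  {y | ∃ x ∈ Φ 0 '' outerSphere (B 0) (M 0), ∃ (γ : ℝ → 𝒱.carrier) (a b : ℝ), a ≤ b ∧
    𝒱.metric.IsFutureCausalCurveOn 𝒱.timeOrientation γ (Icc a b) ∧ γ a = x ∧ γ b = y ∧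
    ∀ t ∈ Icc a b, γ t ∈ frontier (𝒱.metric.causalFuture 𝒱.timeOrientation (collarCore M p B Φ))}

/-! ### F1 — vacuum Cauchy rigidity of the exact thick slab (chart form) -/

/-- **F1 `SlabCauchyRigidity`** — an exact `k'`-jet (`k' ≥ 1`: induced metric AND second
fundamental form of the slab agree with Kerr's) of boosted Kerr on the thick slab of a collar chart
of a MAXIMAL vacuum Cauchy development, core on the Cauchy slice, gives an EXACT chart on the whole
future inner diamond `Δ = D⁺_Kerr(slab)° ∩ {r > M}`, continuous up to the slab where it agrees with
the collar chart, with image in the interior of the Killing domain (indeed in `D⁺(C)°`).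
Ingredients: local uniqueness for the vacuum Cauchy problem (Choquet-Bruhat–Geroch 1969, Thm. 3;
Ringström 2009, Thm. 16.6) + the localisation principle "the MGHD of a datum contains the MGHD of
every open sub-datum" (Hawking–Ellis 1973, §7.6, pp. 249–251; tree: `RelativeDevelopmentGluing*`,
`HypersurfaceDevelopmentGluing`) + the Kerr fact `D⁺_Kerr(slab) ⊇ Δ` (`t*` is a time function,
`r` increases to the past in `{r₋ < r < r₊}`, `v` is non-increasing to the past; DR 0811.0354 §5.1).
MISSING in the tree (its gluing inputs are landed).
(ref: HawkingEllis1973CUP, §7.6, pp. 249–251) (ref: Ringstrom2009, Thm. 16.6)  Route-posited statement of the line; nothing is asserted. [conjecture] [folklore] -/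
def SlabCauchyRigidity : Prop :=
  ∀ (k' : ℕ), 1 ≤ k' →
    ∀ (X : Type) [TopologicalSpace X] [ChartedSpace E3 X] [IsManifold (𝓡 3) ∞ X]
      [T2Space X] [SecondCountableTopology X] [ConnectedSpace X]
      (D : InitialDataSet (𝓡 3) X) (𝒱 : VacuumCauchyDevelopment D)
      (M a : Fin 1 → ℝ) (p : 𝒱.carrier) (mo : Fin 1 → lorentzGroup × E4)
      (B : Fin 1 → ModelBackground) (Φ : ∀ i, (B i).domain → 𝒱.carrier),
    𝒱.IsMaximal → (∀ i, 0 < M i ∧ |a i| < M i) →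
    (∃ i, p ∈ Φ i '' (B i).truncTimeSlab (3 * M i) 0) →
    (∀ i, B i = starBackground (mo i).1 (mo i).2 (M i) (a i)
      (fun x => Kerr.radius (a i) (poincareInv (mo i).1 (mo i).2 x))) →
    (∀ i, ContMDiffOn 𝓘(ℝ, E4) (𝓡 4) ∞ (Φ i)
        {x | -1 < (B i).time x.1 ∧ (B i).time x.1 < 1 ∧ (B i).radius x.1 < 3 * M i + 1} ∧
      IsOpenEmbedding ({x | -1 < (B i).time x.1 ∧ (B i).time x.1 < 1 ∧
        (B i).radius x.1 < 3 * M i + 1}.restrict (Φ i))) →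
    (∀ i, 𝒱.toSpacetime.truncDeviationCk (B i) (Φ i) k' (3 * M i) 0 ≤ 0) →
    collarCore M p B Φ ⊆ range 𝒱.embed →
    ∃ Ψ : (B 0).domain → 𝒱.carrier,
      (∀ x ∈ (B 0).truncTimeSlab (3 * M 0) 0, Ψ x = Φ 0 x) ∧
      ContinuousOn Ψ (slabDiamondWithSlab (B 0) (M 0)) ∧
      ContMDiffOn 𝓘(ℝ, E4) (𝓡 4) ∞ Ψ (slabDiamond (B 0) (M 0)) ∧
      IsOpenEmbedding ((slabDiamond (B 0) (M 0)).restrict Ψ) ∧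
      Ψ '' slabDiamond (B 0) (M 0) ⊆ interior (killingDomain 𝒱 M p B Φ) ∧
      supCkENorm (Subtype.val '' slabDiamond (B 0) (M 0)) 0 (𝒱.toSpacetime.deviationExtend (B 0) Ψ) ≤ 0


/-! ### F4' — the outer roof is Kerr, charted (load-bearing open step of K2, chart form) -/

/-- **F4' `OuterRoofChart`** (K2's hypotheses ⟹ a roof chart for every radius `ρ`, with
`ξ = dΨ_N(Λ e₀)` on its open part and image in the interior of the Killing domain).  This is the
single fact of the route in which the Killing field enters; its paper ingredients are F2 (Müller
zum Hagen), F3 (continuation on the timelike component), the monotonicity `ṙ > 0` of the outgoing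
null normals of `S₃` in Kerr (no outer ergosurface ALONG THE ROOF), the coherence of the local
charts along the simply connected one-sided collar of `N₊ ≅ S² × ℝ` (developing map), and the reach
of `N₊` to every radius (`HasCutBondiMass`: sections of `∂J⁺(C)` of unbounded area lie on `N₊`,
since `N₋` focuses).  OPEN. (ref: MullerZumHagen1970, Theorem) (ref: Carter1968, §3)
(Kobayashi–Nomizu I, Ch. VI, Thm. 6.1 — no bib key in references.bib)  Route-posited statement of the line; nothing is asserted. [conjecture] [folklore] -/
def OuterRoofChart : Prop :=
  ∀ [Kerr.Facts] (k' : ℕ), 2 ≤ k' →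
    ∀ (X : Type) [TopologicalSpace X] [ChartedSpace E3 X] [IsManifold (𝓡 3) ∞ X]
      [T2Space X] [SecondCountableTopology X] [ConnectedSpace X]
      (D : InitialDataSet (𝓡 3) X) (𝒱 : VacuumCauchyDevelopment D)
      (M a : Fin 1 → ℝ) (p : 𝒱.carrier) (mo : Fin 1 → lorentzGroup × E4)
      (B : Fin 1 → ModelBackground) (Φ : ∀ i, (B i).domain → 𝒱.carrier)
      (hmax : 𝒱.IsMaximal) (hpar : ∀ i, 0 < M i ∧ |a i| < M i),
    (∃ i, p ∈ Φ i '' (B i).truncTimeSlab (3 * M i) 0) →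
    (∀ i, B i = starBackground (mo i).1 (mo i).2 (M i) (a i)
      (fun x => Kerr.radius (a i) (poincareInv (mo i).1 (mo i).2 x))) →
    (∀ i, ContMDiffOn 𝓘(ℝ, E4) (𝓡 4) ∞ (Φ i)
        {x | -1 < (B i).time x.1 ∧ (B i).time x.1 < 1 ∧ (B i).radius x.1 < 3 * M i + 1} ∧
      IsOpenEmbedding ({x | -1 < (B i).time x.1 ∧ (B i).time x.1 < 1 ∧
        (B i).radius x.1 < 3 * M i + 1}.restrict (Φ i))) →
    (∀ i, 𝒱.toSpacetime.truncDeviationCk (B i) (Φ i) k' (3 * M i) 0 ≤ 0) →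
    collarCore M p B Φ ⊆ range 𝒱.embed →
    (∃ m : ℝ, 𝒱.toCauchyDevelopment.HasCutBondiMass (collarCore M p B Φ) m) →
    ∀ [𝒱.metric.toPseudoRiemannianMetric.HasLeviCivita],
    ∀ (ξ : Π x : 𝒱.carrier, TangentSpace (𝓡 4) x),
    𝒱.metric.IsKillingFieldOn ξ (interior (killingDomain 𝒱 M p B Φ)) →
    (∃ (τ₁ r₁ r₂ : ℝ) (Ψ : (B 0).domain → 𝒱.carrier),
        0 < τ₁ ∧ 2 * M 0 ≤ r₁ ∧ r₁ < r₂ ∧ r₂ ≤ 3 * M 0 ∧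
        IsNearModelBox 𝒱.toSpacetime (B 0) k' 0 0 τ₁ r₁ r₂ (interior (killingDomain 𝒱 M p B Φ)) Ψ ∧
        ∀ x ∈ coordBox (B 0) 0 τ₁ r₁ r₂,
          ξ (Ψ x) = mfderiv 𝓘(ℝ, E4) (𝓡 4) Ψ x (((mo 0).1 : E4 ≃L[ℝ] E4) (E4.basisVector 0))) →
    ∀ ρ : ℝ, ∃ (O : Set (Kerr.region (a 0) (M 0))) (Ψ : (B 0).domain → 𝒱.carrier),
      IsRoofChart (mo 0) (M 0) (a 0) (hpar 0).1 (B 0) (collarCore M p B Φ)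
        (interior (killingDomain 𝒱 M p B Φ)) (Φ 0) ρ O Ψ ∧
      ∀ x ∈ pullK (mo 0) (M 0) (a 0) (B 0) (O ∩ interior (JK (M 0) (a 0) (hpar 0).1 (slabK (M 0) (a 0)))),
        ξ (Ψ x) = mfderiv 𝓘(ℝ, E4) (𝓡 4) Ψ x (((mo 0).1 : E4 ≃L[ℝ] E4) (E4.basisVector 0))

/-! ### F5 — Kerr slab + Kerr roof ⟹ the truncated causal future is Kerr (semi-global uniqueness) -/

/-- **F5 `RoofDevelopmentExtension`** — in a MAXIMAL vacuum Cauchy development with an exact thick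
collar (`k' ≥ 1`) on its Cauchy slice and a roof chart for every radius (`IsRoofChart`, no Killing
field involved), there is, for every `ρ, T₀`, an EXACT chart of the collar background on the
pull-back of the truncated open causal future `J⁺_Kerr(slab)° ∩ {t* < T₀, r < ρ}`, with image in
`J⁺(C)`.  Ingredients: uniqueness for the vacuum Cauchy–CHARACTERISTIC problem with data on the
slab and on the outgoing null hypersurface from its edge (Rendall 1990, Thm. 1 and §5; the
reduction to harmonic gauge); `J⁺_Kerr(slab)° ∩ {r > M} ⊆ D⁺_Kerr(slab ∪ C⁺(S₃))` (past-directed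
causal curves from `{r > M}` never reach the inner sheet: `r` increases to the past in
`{r₋ < r < r₊}`); the maximality/gluing argument placing the maximal Cauchy–characteristic
development inside the MGHD (Choquet-Bruhat–Geroch 1969; Sbierski 2016 §3; Hawking–Ellis §7.6).
MISSING in the tree (no characteristic initial value problem is vendored). (ref: Rendall1990, Thm. 1)
(ref: ChoquetBruhatGeroch1969CMP, Thm. 3) (ref: HawkingEllis1973CUP, §7.6)  Route-posited statement of the line; nothing is asserted. [conjecture] [folklore] -/
def RoofDevelopmentExtension : Prop :=
  ∀ [Kerr.Facts] (k' : ℕ), 1 ≤ k' →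
    ∀ (X : Type) [TopologicalSpace X] [ChartedSpace E3 X] [IsManifold (𝓡 3) ∞ X]
      [T2Space X] [SecondCountableTopology X] [ConnectedSpace X]
      (D : InitialDataSet (𝓡 3) X) (𝒱 : VacuumCauchyDevelopment D)
      (M a : Fin 1 → ℝ) (p : 𝒱.carrier) (mo : Fin 1 → lorentzGroup × E4)
      (B : Fin 1 → ModelBackground) (Φ : ∀ i, (B i).domain → 𝒱.carrier)
      (hmax : 𝒱.IsMaximal) (hpar : ∀ i, 0 < M i ∧ |a i| < M i),
    (∃ i, p ∈ Φ i '' (B i).truncTimeSlab (3 * M i) 0) →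
    (∀ i, B i = starBackground (mo i).1 (mo i).2 (M i) (a i)
      (fun x => Kerr.radius (a i) (poincareInv (mo i).1 (mo i).2 x))) →
    (∀ i, ContMDiffOn 𝓘(ℝ, E4) (𝓡 4) ∞ (Φ i)
        {x | -1 < (B i).time x.1 ∧ (B i).time x.1 < 1 ∧ (B i).radius x.1 < 3 * M i + 1} ∧
      IsOpenEmbedding ({x | -1 < (B i).time x.1 ∧ (B i).time x.1 < 1 ∧
        (B i).radius x.1 < 3 * M i + 1}.restrict (Φ i))) →
    (∀ i, 𝒱.toSpacetime.truncDeviationCk (B i) (Φ i) k' (3 * M i) 0 ≤ 0) →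
    collarCore M p B Φ ⊆ range 𝒱.embed →
    (∀ ρ : ℝ, ∃ (O : Set (Kerr.region (a 0) (M 0))) (Ψ : (B 0).domain → 𝒱.carrier),
      IsRoofChart (mo 0) (M 0) (a 0) (hpar 0).1 (B 0) (collarCore M p B Φ)
        (𝒱.metric.causalFuture 𝒱.timeOrientation (collarCore M p B Φ)) (Φ 0) ρ O Ψ) →
    ∀ ρ T₀ : ℝ, ∃ Ψ : (B 0).domain → 𝒱.carrier,
      ContMDiffOn 𝓘(ℝ, E4) (𝓡 4) ∞ Ψ (pullK (mo 0) (M 0) (a 0) (B 0) (truncFutureK (M 0) (a 0) (hpar 0).1 ρ T₀)) ∧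
      IsOpenEmbedding ((pullK (mo 0) (M 0) (a 0) (B 0) (truncFutureK (M 0) (a 0) (hpar 0).1 ρ T₀)).restrict Ψ) ∧
      Ψ '' pullK (mo 0) (M 0) (a 0) (B 0) (truncFutureK (M 0) (a 0) (hpar 0).1 ρ T₀) ⊆
        𝒱.metric.causalFuture 𝒱.timeOrientation (collarCore M p B Φ) ∧
      supCkENorm (Subtype.val '' pullK (mo 0) (M 0) (a 0) (B 0) (truncFutureK (M 0) (a 0) (hpar 0).1 ρ T₀)) 0
        (𝒱.toSpacetime.deviationExtend (B 0) Ψ) ≤ 0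

/-! ### F6 — late Kerr-star boxes of every size sit in the open causal future of the slab (pure Kerr) -/

/-- **F6 `KerrLateBoxPlacement`** — in the Kerr star chart `{r > M}`, `0 < M`, `|a| < M`: for all
`R, T` there are `τ, ρ, T₀` with `{τ < t* < τ + T, M < r < R + 1} ⊆ J⁺(slab)° ∩ {t* < T₀, r < ρ}`.
Paper proof: `J⁺(slab) ⊇ {t* > 0, M < r ≤ 3M}` (points with `v = t* + r < 3M` lie in `D⁺(slab)`;
the others are reached by the `∂_{t*}`-orbit of a shell point — timelike for `r > 2M` — followed by
an ingoing principal null ray `v = const`), and `J⁺(slab) ∩ {r > 3M}` is bounded by the cone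
`C⁺(S₃)`, which passes radius `r` at `t* = t_N(r) < ∞` (outgoing null normals of `S₃` have
`ṙ > 0` and reach every radius); take `τ > t_N(R + 1)`, `T₀ = τ + T`, `ρ = R + 1`.  MISSING in the
tree (Kerr causal geometry in the star chart; explicit curves — closable). (ref: DafermosRodnianski2008, §5.1)
(ref: ONeill1995, Ch. 4)  Route-posited statement of the line; nothing is asserted. [conjecture] [folklore] -/
def KerrLateBoxPlacement : Prop :=
  ∀ [Kerr.Facts] (M a R T : ℝ) (hM : 0 < M), |a| < M →
    ∃ τ ρ T₀ : ℝ, boxK M a τ (τ + T) M (R + 1) ⊆ truncFutureK M a hM ρ T₀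

/-! ### The glue: K2 ⟸ F4' ∧ F5 ∧ F6 (the Kerr chart facts `[Kerr.Facts]` are discharged in the tree) -/

/-- **K2 follows from F4', F5, F6** (pure bookkeeping: F4' gives the roof charts — moved into
`J⁺(C)` by `killingDomain ⊆ J⁺(C)` —, F5 the exact chart on the truncated causal future, F6 places
the requested box inside it, and an exact chart restricts to an exact box of every order). -/
theorem K2_of_route (h4 : OuterRoofChart) (h5 : RoofDevelopmentExtension)
    (h6 : KerrLateBoxPlacement) : ∀ (k' : ℕ), 2 ≤ k' →
    ∀ (X : Type) [TopologicalSpace X] [ChartedSpace E3 X] [IsManifold (𝓡 3) ∞ X]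
      [T2Space X] [SecondCountableTopology X] [ConnectedSpace X]
      (D : InitialDataSet (𝓡 3) X) (𝒱 : VacuumCauchyDevelopment D)
      (M a : Fin 1 → ℝ) (p : 𝒱.carrier) (mo : Fin 1 → lorentzGroup × E4)
      (B : Fin 1 → ModelBackground) (Φ : ∀ i, (B i).domain → 𝒱.carrier),
    𝒱.IsMaximal → (∀ i, 0 < M i ∧ |a i| < M i) →
    (∃ i, p ∈ Φ i '' (B i).truncTimeSlab (3 * M i) 0) →
    (∀ i, B i = starBackground (mo i).1 (mo i).2 (M i) (a i)
      (fun x => Kerr.radius (a i) (poincareInv (mo i).1 (mo i).2 x))) →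
    (∀ i, ContMDiffOn 𝓘(ℝ, E4) (𝓡 4) ∞ (Φ i)
        {x | -1 < (B i).time x.1 ∧ (B i).time x.1 < 1 ∧ (B i).radius x.1 < 3 * M i + 1} ∧
      IsOpenEmbedding ({x | -1 < (B i).time x.1 ∧ (B i).time x.1 < 1 ∧
        (B i).radius x.1 < 3 * M i + 1}.restrict (Φ i))) →
    (∀ i, 𝒱.toSpacetime.truncDeviationCk (B i) (Φ i) k' (3 * M i) 0 ≤ 0) →
    collarCore M p B Φ ⊆ range 𝒱.embed →
    (∃ m : ℝ, 𝒱.toCauchyDevelopment.HasCutBondiMass (collarCore M p B Φ) m) →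
    ∀ [𝒱.metric.toPseudoRiemannianMetric.HasLeviCivita],
    ∀ (ξ : Π x : 𝒱.carrier, TangentSpace (𝓡 4) x),
    𝒱.metric.IsKillingFieldOn ξ (interior (killingDomain 𝒱 M p B Φ)) →
    (∃ (τ₁ r₁ r₂ : ℝ) (Ψ : (B 0).domain → 𝒱.carrier),
        0 < τ₁ ∧ 2 * M 0 ≤ r₁ ∧ r₁ < r₂ ∧ r₂ ≤ 3 * M 0 ∧
        IsNearModelBox 𝒱.toSpacetime (B 0) k' 0 0 τ₁ r₁ r₂ (interior (killingDomain 𝒱 M p B Φ)) Ψ ∧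
        ∀ x ∈ coordBox (B 0) 0 τ₁ r₁ r₂,
          ξ (Ψ x) = mfderiv 𝓘(ℝ, E4) (𝓡 4) Ψ x (((mo 0).1 : E4 ≃L[ℝ] E4) (E4.basisVector 0))) →
    ∀ (k : ℕ) (R T : ℝ), ∃ (τ : ℝ) (Ψ : (B 0).domain → 𝒱.carrier),
      IsNearModelBox 𝒱.toSpacetime (B 0) k 0 τ (τ + T) (M 0) (R + 1)
        (𝒱.metric.causalFuture 𝒱.timeOrientation (collarCore M p B Φ)) Ψ := by
  haveI : Kerr.Facts :=
    ⟨Kerr.isConnected_region_holds, Kerr.contMDiff_bilin_holds, Kerr.contMDiff_timeVector_holds⟩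
  intro k' hk' X _ _ _ _ _ _ D 𝒱 M a p mo B Φ hmax hpar hp hB hΦ hdev hCX hcut _ ξ hξ hbox k R T
  -- F4': roof charts (image in `interior killingDomain ⊆ J⁺(C)`)
  have hroof := h4 k' hk' X D 𝒱 M a p mo B Φ hmax hpar hp hB hΦ hdev hCX hcut ξ hξ hbox
  have hroof' : ∀ ρ : ℝ, ∃ (O : Set (Kerr.region (a 0) (M 0))) (Ψ : (B 0).domain → 𝒱.carrier),
      IsRoofChart (mo 0) (M 0) (a 0) (hpar 0).1 (B 0) (collarCore M p B Φ)
        (𝒱.metric.causalFuture 𝒱.timeOrientation (collarCore M p B Φ)) (Φ 0) ρ O Ψ := by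
    intro ρ
    obtain ⟨O, Ψ, ⟨hO, hsub, hs, he, hJ, hd, hc, hfr, hS⟩, -⟩ := hroof ρ
    exact ⟨O, Ψ, hO, hsub, hs, he,
      hJ.trans (interior_subset.trans (killingDomain_subset_causalFuture 𝒱 M p B Φ)), hd, hc, hfr, hS⟩
  -- F5: exact chart on the truncated causal future, for every `ρ, T₀`
  have hext := h5 k' (le_trans one_le_two hk') X D 𝒱 M a p mo B Φ hmax hpar hp hB hΦ hdev hCX hroof'
  -- F6: place the box
  obtain ⟨τ, ρ, T₀, hplace⟩ := h6 (M 0) (a 0) R T (hpar 0).1 (hpar 0).2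
  obtain ⟨Ψ, hs, he, hJ, hd⟩ := hext ρ T₀
  refine ⟨τ, Ψ, ?_⟩
  have hsub : coordBox (B 0) τ (τ + T) (M 0) (R + 1) ⊆
      pullK (mo 0) (M 0) (a 0) (B 0) (truncFutureK (M 0) (a 0) (hpar 0).1 ρ T₀) :=
    (coordBox_subset_pullK_boxK (hB 0) τ (τ + T) (M 0) (R + 1)).trans (pullK_mono _ _ _ _ hplace)
  have hopen : IsOpen (coordBox (B 0) τ (τ + T) (M 0) (R + 1)) := by
    rw [hB 0]
    exact isOpen_coordBox (continuous_time_starBackground _ _ _ _ _)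
      (continuous_radius_starBackground _ _ _ _) _ _ _ _
  exact isNearModelBox_of_exactOn hs he hJ hd hsub hopen
    (isOpen_image_val_coordBox_of_eq_starBackground (hB 0) _ _ _ _) k

end K2Route

/-- **Registered sub-goal of the line** (`stub_stationaryKerrCollarExtensionOfRoute`): the closed form of
the checked reduction — the three route statements imply the registered K2 signature verbatim.
[cite: Rendall1990, Thm. 1] -/
theorem stub_stationaryKerrCollarExtensionOfRoute : K2Route.OuterRoofChart → K2Route.RoofDevelopmentExtension → K2Route.KerrLateBoxPlacement → ∀ (k' : ℕ), 2 ≤ k' → ∀ (X : Type) [TopologicalSpace X] [ChartedSpace E3 X] [IsManifold (𝓡 3) ∞ X] [T2Space X] [SecondCountableTopology X] [ConnectedSpace X] (D : InitialDataSet (𝓡 3) X) (𝒱 : VacuumCauchyDevelopment D) (M a : Fin 1 → ℝ) (p : 𝒱.carrier) (mo : Fin 1 → lorentzGroup × E4) (B : Fin 1 → ModelBackground) (Φ : ∀ i, (B i).domain → 𝒱.carrier), 𝒱.IsMaximal → (∀ i, 0 < M i ∧ |a i| < M i) → (∃ i, p ∈ Φ i '' (B i).truncTimeSlab (3 * M i)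 0) → (∀ i, B i = starBackground (mo i).1 (mo i).2 (M i) (a i) (fun x => Kerr.radius (a i) (poincareInv (mo i).1 (mo i).2 x))) → (∀ i, ContMDiffOn 𝓘(ℝ, E4) (𝓡 4) ∞ (Φ i) {x | -1 < (B i).time x.1 ∧ (B i).time x.1 < 1 ∧ (B i).radius x.1 < 3 * M i + 1} ∧ IsOpenEmbedding ({x | -1 < (B i).time x.1 ∧ (B i).time x.1 < 1 ∧ (B i).radius x.1 < 3 * M i + 1}.restrict (Φ i))) → (∀ i, 𝒱.toSpacetime.truncDeviationCk (B i) (Φ i) k' (3 * M i) 0 ≤ 0) → collarCore M p B Φ ⊆ range 𝒱.embed → (∃ m : ℝ, 𝒱.toCauchyDevelopment.HasCutBondiMass (collarCore M p B Φ) m) → ∀ [𝒱.metric.toPseudoRiemannianMetric.HasLeviCivita], ∀ (ξ : Π x : 𝒱.carrier, TangentSpace (𝓡 4) x), 𝒱.metric.IsKillingFieldOn ξ (interior (killingDomain 𝒱 M p B Φ)) → (∃ (τ₁ r₁ r₂ : ℝ) (Ψ : (B 0).domain → 𝒱.carrier), 0 < τ₁ ∧ 2 * M 0 ≤ r₁ ∧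 r₁ < r₂ ∧ r₂ ≤ 3 * M 0 ∧ IsNearModelBox 𝒱.toSpacetime (B 0) k' 0 0 τ₁ r₁ r₂ (interior (killingDomain 𝒱 M p B Φ)) Ψ ∧ ∀ x ∈ coordBox (B 0) 0 τ₁ r₁ r₂, ξ (Ψ x) = mfderiv 𝓘(ℝ, E4) (𝓡 4) Ψ x (((mo 0).1 : E4 ≃L[ℝ] E4) (E4.basisVector 0))) → ∀ (k : ℕ) (R T : ℝ), ∃ (τ : ℝ) (Ψ : (B 0).domain → 𝒱.carrier), IsNearModelBox 𝒱.toSpacetime (B 0) k 0 τ (τ + T) (M 0) (R + 1) (𝒱.metric.causalFuture 𝒱.timeOrientation (collarCore M p B Φ)) Ψ :=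
  fun h4 h5 h6 ↦ K2Route.K2_of_route h4 h5 h6

end Summit.FinalStateConjecture.FinalStateConjecture.Theorems.BondiBartnikRigidity.DirectMethod

end
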